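import Summits.BirchSwinnertonDyer.BirchSwinnertonDyer.Theorems.ClassRecordThreeEulerHalvesAtThreeCartanDegreeDefs
import HarnessLib

/-!
# Crux 19109 `EulerHalvesAtThree` ∕ 23422 line `cartan` v8, stub (F2a): the TORUS-CUBE CUT of S-K1′ — file 1/2: the FRAME
# (norm operators of the two tori and of the cube subgroup, the pairing lemma, the rank-one trace identity; all proved)

Seat `bsd-idea-10` g11 (planner-bsd-idea-10-g11-0, D-0145 ideator; `--supports stmt-BirchSwinnertonDyer-19109 --as helper`). CONTENT = §§1–3 of the unregistered
workfile `Cruxes/EulerHalvesAtThree/Lines/cartan_sk1.lean` (commit bc8966080569), VERBATIM as to the proofs: for a `CartanTorusLattice q` (`…CartanDegreeDefs`), the norm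
operators `N_S = Σ_{t∈S} ρ(t)` of the split torus `T_s` (`splitTorus`), of the non-split torus `T_C` = centraliser of `η` (`nonsplitTorus`) and of its cube
subgroup `T_C³` (`nonsplitCubes`); their torus-fixedness; `B(N_S y, w) = |S|·B(y, w)` for `S`-fixed `w`; the PAIRING LEMMA (`pairing`)
`A·B(w_S,w_S) = |T_s|·β`, `b·B(w_C,w_C) = |T|·β`, `A·B(w_S,w_S)·|T| = b·B(w_C,w_C)·|T_s|` for `N_{T_s}(ρ(g)w_C) = A·w_S`, `N_T(ρ(g)⁻¹w_S) = b·w_C`,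
`β = B(ρ(g)w_C, w_S)` (from `B_inv` alone); and the RANK-ONE TRACE IDENTITY (`sum_sum_char_eq_trace`, `trace_normOp_conj`)
`Σ_{s∈S,t∈T} χ_W(s g t g⁻¹) = tr(N_S ρ(g) N_T ρ(g)⁻¹) = A·c(ρ(g)⁻¹ w_S)` (from `trace_eq` and Mathlib's `LinearMap.trace_smulRight`); 3-adic bookkeeping.
File 2/2 (`…CartanTorusCubeCut`) states the six finite-group inputs and derives `CartanDegree.CubicTorusPeriodRatioAtThreeGeFive` from them.
HONEST FRAMING: elementary identities about one finite group acting on one lattice; nothing is asserted about any curve, `L`-value or period; S-K1′ is NOT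
proved here; no summit statement, no route item and no registered stub is proved; BSD is proved for no curve. Reference for the background character
theory of `GL₂(𝔽_q)`: [cite: Bump1997, §4.1].
-- adapted from Summits/BirchSwinnertonDyer/BirchSwinnertonDyer/Cruxes/EulerHalvesAtThree/Lines/cartan_sk1.lean (bsd-idea-10 g11), §§1–3
-/

namespace Summit.BirchSwinnertonDyer.BirchSwinnertonDyer.Theorems.CartanTorusCubeCut

open Summit.BirchSwinnertonDyer.BirchSwinnertonDyer.Theorems.CartanDegree

set_option linter.dupNamespace false
set_option linter.unusedSectionVars false
set_option autoImplicit false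

/-- `GL₂(𝔽_q)` -/
abbrev G (q : ℕ) := GL (Fin 2) (ZMod q)
/-- `M₂(𝔽_q)` -/
abbrev Mat (q : ℕ) := Matrix (Fin 2) (Fin 2) (ZMod q)

variable {q : ℕ} [Fact q.Prime]

/-- the split (diagonal) torus `T_s`. -/
noncomputable def splitTorus (q : ℕ) [Fact q.Prime] : Finset (G q) :=
  Finset.univ.filter (fun g => (g : Mat q) 0 1 = 0 ∧ (g : Mat q) 1 0 = 0)

/-- the non-split torus `T_C = 𝔽_q[η]^×` (the centraliser of `η`). -/
noncomputable def nonsplitTorus (η : Mat q) : Finset (G q) :=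
  Finset.univ.filter (fun g => (g : Mat q) * η = η * g)

/-- the cubes `T_C³` of the non-split torus. -/
noncomputable def nonsplitCubes (η : Mat q) : Finset (G q) :=
  (nonsplitTorus η).image (fun t => t ^ 3)

/-- the norm (trace) operator `N_S = Σ_{t ∈ S} ρ(t)` of a finite set of group elements. -/
noncomputable def normOp (𝓛 : CartanTorusLattice q) (S : Finset (G q)) :
    (Fin 𝓛.d → ℤ) →ₗ[ℤ] (Fin 𝓛.d → ℤ) :=
  ∑ t ∈ S, 𝓛.ρ t

/-- the double character sum `S₃(g) = Σ_{s ∈ T_s} Σ_{t ∈ T_C³} χ_W(s·g·t·g⁻¹)`. -/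
noncomputable def S3 (q : ℕ) [Fact q.Prime] (η : Mat q) (g : G q) : ℤ :=
  ∑ s ∈ splitTorus q, ∑ t ∈ nonsplitCubes η, cubicNewvectorChar q (s * g * t * g⁻¹)

/-- `N_S x = Σ_{t ∈ S} ρ(t) x`. -/
theorem normOp_apply (𝓛 : CartanTorusLattice q) (S : Finset (G q)) (x : Fin 𝓛.d → ℤ) :
    normOp 𝓛 S x = ∑ t ∈ S, 𝓛.ρ t x := by
  simp [normOp, LinearMap.sum_apply]

/-- re-indexing a sum over a multiplicatively closed finite set by left multiplication. -/
theorem sum_mul_left_eq {M : Type*} [AddCommMonoid M] {S : Finset (G q)}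
    (hS : ∀ u ∈ S, ∀ s ∈ S, u * s ∈ S) {u : G q} (hu : u ∈ S) (f : G q → M) :
    ∑ s ∈ S, f (u * s) = ∑ s ∈ S, f s := by
  have h1 : S.map ⟨(u * ·), mul_right_injective u⟩ = S := by
    apply Finset.eq_of_subset_of_card_le
    · intro x hx
      rw [Finset.mem_map] at hx
      obtain ⟨s, hs, rfl⟩ := hx
      exact hS u hu s hs
    · rw [Finset.card_map]
  conv_rhs => rw [← h1]
  rw [Finset.sum_map]
  rfl

/-- left translation by an element of a multiplicatively closed `S` fixes `N_S`: `ρ(u) ∘ N_S = N_S`. -/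
theorem rho_mul_normOp (𝓛 : CartanTorusLattice q) {S : Finset (G q)}
    (hS : ∀ u ∈ S, ∀ s ∈ S, u * s ∈ S) {u : G q} (hu : u ∈ S) (x : Fin 𝓛.d → ℤ) :
    𝓛.ρ u (normOp 𝓛 S x) = normOp 𝓛 S x := by
  rw [normOp_apply, map_sum]
  simp_rw [← Module.End.mul_apply, ← map_mul]
  exact sum_mul_left_eq hS hu (fun t => 𝓛.ρ t x)

/-- `T_s` is closed under multiplication. -/
theorem splitTorus_mul_mem {u s : G q} (hu : u ∈ splitTorus q) (hs : s ∈ splitTorus q) :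
    u * s ∈ splitTorus q := by
  simp only [splitTorus, Finset.mem_filter, Finset.mem_univ, true_and] at hu hs ⊢
  simp [Units.val_mul, Matrix.mul_apply, Fin.sum_univ_two, hu.1, hu.2, hs.1, hs.2]

/-- `T_C` is closed under multiplication. -/
theorem nonsplitTorus_mul_mem {η : Mat q} {u s : G q} (hu : u ∈ nonsplitTorus η) (hs : s ∈ nonsplitTorus η) :
    u * s ∈ nonsplitTorus η := by
  simp only [nonsplitTorus, Finset.mem_filter, Finset.mem_univ, true_and] at hu hs ⊢
  rw [Units.val_mul, mul_assoc, hs, ← mul_assoc, hu, mul_assoc]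

/-- `T_C³ ⊂ T_C`. -/
theorem mem_nonsplitTorus_of_mem_cubes {η : Mat q} {t : G q} (ht : t ∈ nonsplitCubes η) :
    (t : Mat q) * η = η * t := by
  simp only [nonsplitCubes, nonsplitTorus, Finset.mem_image, Finset.mem_filter, Finset.mem_univ,
    true_and] at ht
  obtain ⟨u, hu, rfl⟩ := ht
  rw [Units.val_pow_eq_pow_val]
  exact (show Commute (u : Mat q) η from hu).pow_left 3


/-! ### Linear algebra of the norm operators -/

section LinAlg
variable (𝓛 : CartanTorusLattice q)

/-- `ρ(t)(ρ(t⁻¹) x) = x`. -/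
theorem rho_mul_inv_apply (t : G q) (x : (Fin 𝓛.d → ℤ)) : 𝓛.ρ t (𝓛.ρ t⁻¹ x) = x := by
  rw [← Module.End.mul_apply, ← map_mul, mul_inv_cancel, map_one, Module.End.one_apply]

/-- (c3) **norm–form identity**: if `w` is fixed by every element of `S`, then `B(N_S y, w) = |S|·B(y, w)`. -/
theorem B_normOp_left {S : Finset (G q)} {w : (Fin 𝓛.d → ℤ)} (hw : ∀ t ∈ S, 𝓛.ρ t w = w) (y : (Fin 𝓛.d → ℤ)) :
    𝓛.B (normOp 𝓛 S y) w = (S.card : ℤ) * 𝓛.B y w := by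
  rw [normOp_apply, map_sum, LinearMap.sum_apply]
  have : ∀ t ∈ S, 𝓛.B (𝓛.ρ t y) w = 𝓛.B y w := by
    intro t ht
    calc 𝓛.B (𝓛.ρ t y) w = 𝓛.B (𝓛.ρ t y) (𝓛.ρ t w) := by rw [hw t ht]
      _ = 𝓛.B y w := 𝓛.B_inv t y w
  rw [Finset.sum_congr rfl this, Finset.sum_const, nsmul_eq_mul]

/-- the coefficient functional along a non-zero vector `w` of a linear map `N` with image in `ℤ·w`. -/
noncomputable def coeffAlong (N : (Fin 𝓛.d → ℤ) →ₗ[ℤ] (Fin 𝓛.d → ℤ)) (w : (Fin 𝓛.d → ℤ)) (h : ∀ x, ∃ m : ℤ, N x = m • w) (hw : w ≠ 0) :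
    (Fin 𝓛.d → ℤ) →ₗ[ℤ] ℤ where
  toFun x := Classical.choose (h x)
  map_add' x y := by
    apply smul_left_injective ℤ hw
    simp only
    rw [← Classical.choose_spec (h (x + y)), add_smul, ← Classical.choose_spec (h x),
      ← Classical.choose_spec (h y), map_add]
  map_smul' m x := by
    apply smul_left_injective ℤ hw
    simp only [smul_eq_mul, RingHom.id_apply]
    rw [← Classical.choose_spec (h (m • x)), mul_smul, ← Classical.choose_spec (h x), map_smul]

/-- defining property of `coeffAlong`: `N x = (coeffAlong N w h hw x) • w`. -/
theorem coeffAlong_spec (N : (Fin 𝓛.d → ℤ) →ₗ[ℤ] (Fin 𝓛.d → ℤ)) (w : (Fin 𝓛.d → ℤ)) (h : ∀ x, ∃ m : ℤ, N x = m • w) (hw : w ≠ 0) (x : (Fin 𝓛.d → ℤ)) :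
    N x = coeffAlong 𝓛 N w h hw x • w :=
  Classical.choose_spec (h x)

/-- (c4, operator form) the double sum of `ρ` over `S × (g T g⁻¹)` is `N_S ∘ ρ(g) ∘ N_T ∘ ρ(g)⁻¹`. -/
theorem sum_sum_rho_conj (S T : Finset (G q)) (g : G q) :
    ∑ s ∈ S, ∑ t ∈ T, 𝓛.ρ (s * g * t * g⁻¹) = normOp 𝓛 S * (𝓛.ρ g * normOp 𝓛 T * 𝓛.ρ g⁻¹) := by
  simp only [normOp, map_mul, Finset.sum_mul, Finset.mul_sum, mul_assoc]
  exact Finset.sum_comm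

/-- (c4, trace form) `Σ_{s ∈ S} Σ_{t ∈ T} χ_W(s g t g⁻¹) = tr(N_S ρ(g) N_T ρ(g)⁻¹)`. -/
theorem sum_sum_char_eq_trace (S T : Finset (G q)) (g : G q) :
    ∑ s ∈ S, ∑ t ∈ T, cubicNewvectorChar q (s * g * t * g⁻¹) =
      LinearMap.trace ℤ (Fin 𝓛.d → ℤ) (normOp 𝓛 S * (𝓛.ρ g * normOp 𝓛 T * 𝓛.ρ g⁻¹)) := by
  rw [← sum_sum_rho_conj, map_sum]
  refine Finset.sum_congr rfl fun s _ => ?_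
  rw [map_sum]
  exact Finset.sum_congr rfl fun t _ => (𝓛.trace_eq _).symm

/-- (c4) **the rank-one trace identity**: if `N_S` maps into `ℤ·w_S` with `N_S(ρ(g) w_T) = A·w_S`, and `N_T = c(·)·w_T` for a
linear functional `c`, then `tr(N_S ρ(g) N_T ρ(g)⁻¹) = A · c(ρ(g)⁻¹ w_S)`. -/
theorem trace_normOp_conj {S T : Finset (G q)} {wS wT : (Fin 𝓛.d → ℤ)} (g : G q) (A : ℤ)
    (hA : normOp 𝓛 S (𝓛.ρ g wT) = A • wS)
    (c : (Fin 𝓛.d → ℤ) →ₗ[ℤ] ℤ) (hc : ∀ x, normOp 𝓛 T x = c x • wT) :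
    LinearMap.trace ℤ (Fin 𝓛.d → ℤ) (normOp 𝓛 S * (𝓛.ρ g * normOp 𝓛 T * 𝓛.ρ g⁻¹)) = A * c (𝓛.ρ g⁻¹ wS) := by
  have key : normOp 𝓛 S * (𝓛.ρ g * normOp 𝓛 T * 𝓛.ρ g⁻¹) =
      (A • (c ∘ₗ (𝓛.ρ g⁻¹ : (Fin 𝓛.d → ℤ) →ₗ[ℤ] (Fin 𝓛.d → ℤ)))).smulRight wS := by
    apply LinearMap.ext
    intro x
    simp only [Module.End.mul_apply, LinearMap.smulRight_apply, LinearMap.smul_apply, LinearMap.coe_comp,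
      Function.comp_apply, smul_eq_mul]
    rw [hc, map_smul, map_smul, hA, smul_smul, mul_comm]
  rw [key, LinearMap.trace_smulRight]
  simp only [LinearMap.smul_apply, LinearMap.coe_comp, Function.comp_apply, smul_eq_mul]

end LinAlg


/-! ### Fixed vectors and norms -/

section Fixed
variable (𝓛 : CartanTorusLattice q)

/-- `N_{T_s} y` is `T_s`-fixed. -/
theorem isSplitFixed_normOp (y : Fin 𝓛.d → ℤ) : 𝓛.IsSplitFixed (normOp 𝓛 (splitTorus q) y) := by
  intro u hu01 hu10
  exact rho_mul_normOp 𝓛 (fun u hu s hs => splitTorus_mul_mem hu hs)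
    (by simp [splitTorus, hu01, hu10]) y

/-- `N_{T_C} y` is `T_C`-fixed. -/
theorem isNonsplitFixed_normOp (y : Fin 𝓛.d → ℤ) : 𝓛.IsNonsplitFixed (normOp 𝓛 (nonsplitTorus 𝓛.η) y) := by
  intro u hu
  exact rho_mul_normOp 𝓛 (fun u hu s hs => nonsplitTorus_mul_mem hu hs)
    (by simpa [nonsplitTorus] using hu) y

/-- a `T_s`-fixed vector is fixed by every element of `splitTorus q`. -/
theorem splitTorus_fix {wS : Fin 𝓛.d → ℤ} (hS : 𝓛.IsSplitFixed wS) :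
    ∀ t ∈ splitTorus q, 𝓛.ρ t wS = wS := by
  intro t ht
  simp only [splitTorus, Finset.mem_filter, Finset.mem_univ, true_and] at ht
  exact hS t ht.1 ht.2

/-- a `T_C`-fixed vector is fixed by every element of `nonsplitTorus η`. -/
theorem nonsplitTorus_fix {wC : Fin 𝓛.d → ℤ} (hC : 𝓛.IsNonsplitFixed wC) :
    ∀ t ∈ nonsplitTorus 𝓛.η, 𝓛.ρ t wC = wC := by
  intro t ht
  simp only [nonsplitTorus, Finset.mem_filter, Finset.mem_univ, true_and] at ht
  exact hC t ht

/-- a `T_C`-fixed vector is fixed by every element of `nonsplitCubes η`. -/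
theorem nonsplitCubes_fix {wC : Fin 𝓛.d → ℤ} (hC : 𝓛.IsNonsplitFixed wC) :
    ∀ t ∈ nonsplitCubes 𝓛.η, 𝓛.ρ t wC = wC :=
  fun t ht => hC t (mem_nonsplitTorus_of_mem_cubes ht)

/-- (c3) the PAIRING LEMMA: with `N_{T_s}(ρ(g) w_C) = A·w_S` and `N_T(ρ(g)⁻¹ w_S) = b·w_C` (`T ⊂ T_C` fixing `w_C`),
`A·B(w_S,w_S) = |T_s|·β` and `b·B(w_C,w_C) = |T|·β` with `β = B(ρ(g) w_C, w_S)`; hence `A·B(w_S,w_S)·|T| = b·B(w_C,w_C)·|T_s|`. -/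
theorem pairing {T : Finset (G q)} {wS wC : Fin 𝓛.d → ℤ} (hS : 𝓛.IsSplitFixed wS)
    (hT : ∀ t ∈ T, 𝓛.ρ t wC = wC) (g : G q) (A b : ℤ)
    (hA : normOp 𝓛 (splitTorus q) (𝓛.ρ g wC) = A • wS) (hb : normOp 𝓛 T (𝓛.ρ g⁻¹ wS) = b • wC) :
    A * 𝓛.B wS wS = ((splitTorus q).card : ℤ) * 𝓛.B (𝓛.ρ g wC) wS ∧
    b * 𝓛.B wC wC = (T.card : ℤ) * 𝓛.B (𝓛.ρ g wC) wS ∧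
    A * 𝓛.B wS wS * (T.card : ℤ) = b * 𝓛.B wC wC * ((splitTorus q).card : ℤ) := by
  have h1 : A * 𝓛.B wS wS = ((splitTorus q).card : ℤ) * 𝓛.B (𝓛.ρ g wC) wS := by
    have := B_normOp_left 𝓛 (splitTorus_fix 𝓛 hS) (𝓛.ρ g wC)
    rwa [hA, map_smul, LinearMap.smul_apply, smul_eq_mul] at this
  have h2 : b * 𝓛.B wC wC = (T.card : ℤ) * 𝓛.B (𝓛.ρ g wC) wS := by
    have := B_normOp_left 𝓛 hT (𝓛.ρ g⁻¹ wS)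
    rw [hb, map_smul, LinearMap.smul_apply, smul_eq_mul] at this
    rw [this, ← 𝓛.B_inv g (𝓛.ρ g⁻¹ wS) wC, rho_mul_inv_apply, 𝓛.B_symm]
  refine ⟨h1, h2, ?_⟩
  calc A * 𝓛.B wS wS * (T.card : ℤ) = ((splitTorus q).card : ℤ) * 𝓛.B (𝓛.ρ g wC) wS * (T.card : ℤ) := by
        rw [h1]
    _ = (T.card : ℤ) * 𝓛.B (𝓛.ρ g wC) wS * ((splitTorus q).card : ℤ) := by ring
    _ = b * 𝓛.B wC wC * ((splitTorus q).card : ℤ) := by rw [h2]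

end Fixed

/-! ### 3-adic bookkeeping -/

/-- `3^{n+1} ∤ m` gives `m ≠ 0` and `ord₃ m ≤ n`. -/
theorem ne_zero_and_padicValInt_le_of_not_dvd {m : ℤ} {n : ℕ} (h : ¬ (3 : ℤ) ^ (n + 1) ∣ m) :
    m ≠ 0 ∧ padicValInt 3 m ≤ n := by
  have key := padicValInt_dvd_iff (p := 3) (n + 1) m
  push_cast at key
  rw [key] at h
  push Not at h
  exact ⟨h.1, by omega⟩

/-- `3^n ∣ m ≠ 0` gives `n ≤ ord₃ m`. -/
theorem le_padicValInt_of_dvd {m : ℤ} {n : ℕ} (hm : m ≠ 0) (h : (3 : ℤ) ^ n ∣ m) :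
    n ≤ padicValInt 3 m := by
  have key := padicValInt_dvd_iff (p := 3) n m
  push_cast at key
  rw [key] at h
  tauto

/-- `3 ∤ m` gives `ord₃ m = 0`. -/
theorem padicValInt_eq_zero_of_not_three_dvd {m : ℤ} (h : ¬ (3 : ℤ) ∣ m) : padicValInt 3 m = 0 :=
  padicValInt.eq_zero_of_not_dvd (by exact_mod_cast h)


end Summit.BirchSwinnertonDyer.BirchSwinnertonDyer.Theorems.CartanTorusCubeCut
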